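import Summits.BirchSwinnertonDyer.Rank1Residual.P2.CongruentNumberSilentEvenFiveSkeletonDescent
import Summits.BirchSwinnertonDyer.Rank1Residual.P2.CongruentNumberCor515SelmerEight
import Literature.NumberTheory.EllipticCurves.Tian2014.CMPointSystemMonskyDescentOdd
import HarnessLib

/-!
# Cell «bsd-monsky» (prover-A, g12): ROUTE A ON MONSKY'S CASE (12) — `N = pq` ODD, `p ≡ 5 (8)`, `q ≡ 3 (8)`, either sign
# of `(p/q)` — from the Galois skeleton of Tian's CM-point system alone: Monsky's Theorem 5.5, FIRST claim, for Tian's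
# odd-twist point `y_{pq}`; rank `E_{pq}(ℚ) = 1`, `pq` congruent, `Ш(E_{pq})[2^∞] = 0`, odd index

HONEST FRAMING (cell `bsd-monsky`, run/shared/lean/pub/bsd-monsky/, README §1: ONE theorem on ONE explicit infinite
family at the prime `2`; nothing booked). This file asserts NO arithmetic fact and claims NOTHING new on paper: Monsky
PROVED (Thm. 5.5 first claim, Thm. 5.14 (12), Cor. 5.15 (2) «`p₃p₅`», Remark (2), pp. 62–67) that for `D = p₃p₅` his mock
Heegner point `S_D ∈ E_D(ℚ)` has odd index modulo torsion and `rank E_D(ℚ) = 1`, with no Legendre condition. The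
cell's route A transplanted Monsky's SECOND claim (`S_{2D}`, the even twist, Theorem 1.1's algebraic input) onto
Tian's Heegner point `y_{2pq}`; this file transplants the FIRST claim onto Tian's ODD-TWIST point `y_{pq,φ} =
Σ_{t∈φ} χ_{pq}(t) z_t` (Tian (4.6) with the genus character `χ_{pq}`; `CMPointSystemMonskyDescentOdd`) and records the
consequences from the GALOIS SKELETON BINDER alone — `hSk : ∀ p ≡ 5 (8), q ≡ 3 (8), ∃ D : CMPointData (pq),
D.PrintedCore ∧ D.GenusTheoryDisplaysCore` (Tian 2014 Thm. 2.8 (1)–(3), (4.8), the Galois facts, Notations (i)–(iii);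
no Gross–Zagier display, no `2`-Selmer display, no reading mark; binder form, no new named fact):
* (M-y, odd twist) a transversal `φ` of `𝒜/[ϖ′]` and a RATIONAL point `y₁ ∈ E_{pq}(ℚ)` with `transfer_{√−pq} y₁ =
  y_{pq,φ}` and `y₁ ∉ 2E_{pq}(ℚ) + E_{pq}(ℚ)_tor`;
* rank `E_{pq}(ℚ) = 1` (`y₁` non-torsion; `≤ 1` = «`S̄ = ℤ/2`» on the Cor. 5.15 family `p₃p₅`, the tree's exact count
  `#Sel₂(E_{pq}) = 8`, p528474); `pq` is a congruent number; `Ш(E_{pq})[2^∞] = 0`; `y₁` has ODD INDEX against every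
  generator of `E_{pq}(ℚ)/tor` (`monskyOddIndex_odd_three_mod_eight_of_skeleton`).
In the tree the odd family `p₃p₅` was so far reached through TYZ's genus-point criterion (DOOR A, relative to
{`tyz_genusPointData`, GZK}); this is a second, Gross–Zagier-free proof of rank one there, by Monsky's own route on Tian's
points. Nothing is asserted unconditionally beyond the tree's own descent theorems.
[cite: Monsky1990MockHeegner, Thm. 5.5 (p. 62), Lemma 5.4 (p. 62), Thm. 5.14 (12) (p. 66), Cor. 5.15 (2) (p. 66), Remark (2) (p. 67)]
[cite: Tian2014, (4.6) (p0022 L84–L96), Lemma 4.7 (J151–152), Thm. 2.8 (p0011 L37–L44), Notations (i)–(iii) (J122–123)]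
[cite: SilvermanAEC2009, Thm. X.4.2, Thm. VIII.6.7] [cite: TopYui2008Congruent, Prop. 3.3 (i) ⟺ (iv)]
-/

noncomputable section

open scoped Classical NumberTheorySymbols

open WeierstrassCurve NumberField Literature.NumberTheory.EllipticCurves
  Literature.NumberTheory.EllipticCurves.Rank1Residual
  Literature.NumberTheory.EllipticCurves.Rank1Residual.Typed
  Literature.NumberTheory.EllipticCurves.Monsky1990
  Literature.NumberTheory.EllipticCurves.TianYuanZhang2017

set_option autoImplicit false

namespace Summit.BirchSwinnertonDyer.Rank1Residual.P2

open Conjectures Literature.NumberTheory.EllipticCurves.Tian2014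

/-! ## §1 The odd family `p₅q₃` is a Cor. 5.15 family -/

/-- **`pq` with `p ≡ 5 (8)`, `q ≡ 3 (8)` is Monsky's family `p₃p₅` of Cor. 5.15 (2)** (`N = q·p`).
[cite: Monsky1990MockHeegner, Cor. 5.15 (2) (p. 66)] -/
theorem isCor515Family_five_mul_three {p q : ℕ} (hp : p.Prime) (hq : q.Prime) (hp8 : p % 8 = 5) (hq8 : q % 8 = 3) :
    IsCor515Family (p * q) :=
  Or.inr (Or.inr (Or.inl ⟨q, p, hq, hp, hq8, Or.inr hp8, mul_comm p q⟩))

/-! ## §2 Rank one, congruent, `Ш[2^∞] = 0` and Monsky's odd index on the odd family from the skeleton binder -/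

/-- **Rank `E_{pq}(ℚ) = 1` on all of Monsky's case (12) from the skeleton binder alone** (`p ≡ 5 (8)`, `q ≡ 3 (8)`, either
sign of `(p/q)`): Tian's odd-twist point gives a rational point `y₁ ∉ 2E + tor` (Monsky Thm. 5.5, first claim, transplanted),
so `rank ≥ 1`; `rank ≤ 1` is the tree's exact count `#Sel₂(E_{pq}) = 8`. No Gross–Zagier input.
[cite: Monsky1990MockHeegner, Thm. 5.5 (p. 62), Thm. 5.14 (12) (p. 66), Remark (2) (p. 67)] [cite: SilvermanAEC2009, Thm. X.4.2] -/
theorem mordellWeilRank_eq_one_odd_three_mod_eight_of_skeleton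
    (hSk : ∀ p q : ℕ, (hp : p.Prime) → (hq : q.Prime) → p % 8 = 5 → q % 8 = 3 →
      ∃ D : CMPointData (p * q), D.PrintedCore ∧ D.GenusTheoryDisplaysCore) :
    ∀ p q : ℕ, p.Prime → q.Prime → p % 8 = 5 → q % 8 = 3 →
      (congruentNumberCurve (p * q)).mordellWeilRank = 1 := by
  intro p q hp hq hp8 hq8
  have hN : IsCor515Family (p * q) := isCor515Family_five_mul_three hp hq hp8 hq8
  haveI := isElliptic_congruentNumberCurve hN.ne_zero
  obtain ⟨D, hP, hG⟩ := hSk p q hp hq hp8 hq8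
  obtain ⟨θ', hθ', hθ'0, φ, -, y₁, -, hnot⟩ := D.exists_minusYChi_of_core_three_mod_eight hP hp hq hp8 hq8 hG
  exact le_antisymm (mordellWeilRank_le_one_of_isCor515Family hN)
    (Nat.one_le_iff_ne_zero.mpr (mordellWeilRank_ne_zero_of_not_two_smul_add_torsion hN.ne_zero y₁ hnot))

/-- **`pq` is a congruent number on all of Monsky's case (12) from the skeleton binder alone** (Cor. 5.15 (2) «`p₃p₅`»).
[cite: Monsky1990MockHeegner, Cor. 5.15 (2) (p. 66)] [cite: TopYui2008Congruent, Prop. 3.3 (i) ⟺ (iv)] -/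
theorem isCongruentNumber_odd_three_mod_eight_of_skeleton
    (hSk : ∀ p q : ℕ, (hp : p.Prime) → (hq : q.Prime) → p % 8 = 5 → q % 8 = 3 →
      ∃ D : CMPointData (p * q), D.PrintedCore ∧ D.GenusTheoryDisplaysCore) :
    ∀ p q : ℕ, p.Prime → q.Prime → p % 8 = 5 → q % 8 = 3 → IsCongruentNumber (p * q) :=
  fun p q hp hq hp8 hq8 =>
    (Wiles2000.mordellWeilRank_ne_zero_iff_isCongruentNumber (mul_pos hp.pos hq.pos)).mp
      (by rw [mordellWeilRank_eq_one_odd_three_mod_eight_of_skeleton hSk p q hp hq hp8 hq8]; exact one_ne_zero)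

/-- **`Ш(E_{pq})[2^∞] = 0` on all of Monsky's case (12) from the skeleton binder alone** (rank one and the exact count
`#Sel₂(E_{pq}) = 8`). [cite: Monsky1990MockHeegner, Remark (2) (p. 67)] [cite: SilvermanAEC2009, Thm. X.4.2] -/
theorem primaryComponent_sha_two_eq_bot_odd_three_mod_eight_of_skeleton
    (hSk : ∀ p q : ℕ, (hp : p.Prime) → (hq : q.Prime) → p % 8 = 5 → q % 8 = 3 →
      ∃ D : CMPointData (p * q), D.PrintedCore ∧ D.GenusTheoryDisplaysCore) :
    ∀ p q : ℕ, (hp : p.Prime) → (hq : q.Prime) → p % 8 = 5 → q % 8 = 3 →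
      haveI := isElliptic_congruentNumberCurve (n := p * q) (Nat.mul_ne_zero hp.ne_zero hq.ne_zero)
      AddCommGroup.primaryComponent (congruentNumberCurve (p * q)).sha 2 = ⊥ := by
  intro p q hp hq hp8 hq8
  have hN : IsCor515Family (p * q) := isCor515Family_five_mul_three hp hq hp8 hq8
  have h := (isCongruentNumber_iff_primaryComponent_sha_two_eq_bot_of_isCor515Family hN).mp
    (isCongruentNumber_odd_three_mod_eight_of_skeleton hSk p q hp hq hp8 hq8)
  convert h

/-- **MONSKY'S ODD-INDEX THEOREM FOR TIAN'S ODD-TWIST POINT, on all of Monsky's case (12), from the skeleton binder alone**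
(Thm. 5.5 first claim with Remark (2), PRINTED for Monsky's `S_D`; here for Tian's `y_{pq,φ}`): for every `p ≡ 5 (8)`,
`q ≡ 3 (8)` and skeleton system `D`, there are `θ′ = √−pq ∈ H(i)`, a transversal `φ` of `𝒜/[ϖ′]` and a rational point
`y₁ ∈ E_{pq}(ℚ)` with `transfer_{θ′} y₁ = y_{pq,φ}`, of INFINITE ORDER and ODD INDEX against every generator of
`E_{pq}(ℚ)/tor`. No `L`-function, no Gross–Zagier display, no `2`-Selmer display, no reading mark.
[cite: Monsky1990MockHeegner, Thm. 5.5 (p. 62), Thm. 5.14 (12) (p. 66), Remark (2) (p. 67)]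
[cite: Tian2014, (4.6) (p0022 L84–L96), Lemma 4.7 (J151–152)] -/
theorem monskyOddIndex_odd_three_mod_eight_of_skeleton
    (hSk : ∀ p q : ℕ, (hp : p.Prime) → (hq : q.Prime) → p % 8 = 5 → q % 8 = 3 →
      ∃ D : CMPointData (p * q), D.PrintedCore ∧ D.GenusTheoryDisplaysCore) :
    ∀ p q : ℕ, p.Prime → q.Prime → p % 8 = 5 → q % 8 = 3 →
      ∃ D : CMPointData (p * q), D.PrintedCore ∧ D.GenusTheoryDisplaysCore ∧
        ∃ (θ' : D.H) (hθ' : θ' ^ 2 = algebraMap ℚ D.H (-((p * q : ℕ) : ℚ))) (hθ'0 : θ' ≠ 0)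
          (φ : Finset (ClassGroup (𝓞 (GenusField (2 * (p * q)))))), D.IsRepsModPiPrime φ ∧
          ∃ y₁ : (congruentNumberCurve (p * q)).toAffine.Point,
            transferE (p * q) θ' hθ' hθ'0 y₁ = D.yPointChi θ' φ ∧ ¬ IsOfFinAddOrder y₁ ∧
            (∀ g : (congruentNumberCurve (p * q)).toAffine.Point, GeneratesFreePartRat (p * q) g →
              ∃ m : ℤ, Odd m ∧ IsOfFinAddOrder (y₁ - m • g)) := by
  intro p q hp hq hp8 hq8
  obtain ⟨D, hP, hG⟩ := hSk p q hp hq hp8 hq8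
  obtain ⟨θ', hθ', hθ'0, φ, hφ, y₁, hy₁, hnot⟩ := D.exists_minusYChi_of_core_three_mod_eight hP hp hq hp8 hq8 hG
  exact ⟨D, hP, hG, θ', hθ', hθ'0, φ, hφ, y₁, hy₁, not_isOfFinAddOrder_of_not_two_smul_add_torsion y₁ hnot,
    fun g hg => exists_odd_isOfFinAddOrder_sub_zsmul_of_not_two_smul_add_torsion y₁ hnot g hg⟩

/-- **Monsky's Theorem 5.5 in FULL, for Tian's points, on all of case (12)/(13), from ONE skeleton binder**: for
`p ≡ 5 (8)`, `q ≡ 3 (8)` (either sign) both `N = pq` (first claim) and `N = 2pq` (second claim) have rank one, are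
congruent numbers, have `Ш[2^∞] = 0`, and carry a Heegner point of odd index — the odd twist from this file, the even twist
from `monskyOddIndex_three_mod_eight_of_skeleton`. [cite: Monsky1990MockHeegner, Thm. 5.5 (p. 62), Thm. 5.14 (12)(13) (p. 66), Cor. 5.15 (2) (p. 66)] -/
theorem monsky_thm55_both_twists_of_skeleton
    (hSk : ∀ p q : ℕ, (hp : p.Prime) → (hq : q.Prime) → p % 8 = 5 → q % 8 = 3 →
      ∃ D : CMPointData (p * q), D.PrintedCore ∧ D.GenusTheoryDisplaysCore) :
    ∀ p q : ℕ, p.Prime → q.Prime → p % 8 = 5 → q % 8 = 3 →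
      ((congruentNumberCurve (p * q)).mordellWeilRank = 1 ∧ IsCongruentNumber (p * q)) ∧
      ((congruentNumberCurve (2 * (p * q))).mordellWeilRank = 1 ∧ IsCongruentNumber (2 * (p * q))) :=
  fun p q hp hq hp8 hq8 =>
    ⟨⟨mordellWeilRank_eq_one_odd_three_mod_eight_of_skeleton hSk p q hp hq hp8 hq8,
      isCongruentNumber_odd_three_mod_eight_of_skeleton hSk p q hp hq hp8 hq8⟩,
      (monskyOddIndex_three_mod_eight_of_skeleton hSk p q hp hq hp8 hq8).1,
      (monskyOddIndex_three_mod_eight_of_skeleton hSk p q hp hq hp8 hq8).2.1⟩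

end Summit.BirchSwinnertonDyer.Rank1Residual.P2

end
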